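import Literature.AlgebraicGeometry.Deformation.SmoothSchemeLiftObstructionRefine
import Literature.AlgebraicGeometry.Morphisms.CechModuleH2
import HarnessLib

/-!
# The refined Čech obstruction 2-cochain is an obstruction cochain of the restricted lifts
# (Hartshorne, *Deformation Theory*, proof of Thm. 10.2 (a): independence of the cover — the restriction half, conclusion)

Layer `Literature/AlgebraicGeometry/Deformation`, namespace `Literature.AlgebraicGeometry.Deformation` (THEOREMS only: no
definition, no instance, no notation, no named fact).  Second half of `SmoothSchemeLiftObstructionRefine` (cover lemmas for a
refinement `𝔚` of the principal affine cover `𝔘` BY BASIC OPENS of its members, `W s = D(a s) ⊆ U (τ s)`; the restricted lifts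
`ψ^W s t` on `A' ⊗_k Γ(W s ∩ W t)`), in the currency of ★ F2 `SmoothSchemeLiftObstructionCechCocycle` verbatim (the
`variable`s, the REPRESENTATION clause «`u (1 ⊗ c) = 1 ⊗ c + t ⊗ θ(dc)`», the characterisation `ho` of an obstruction
cochain) and of ★ `Morphisms/CechModuleH2Refinement` (`ρ_τ : Č²(𝔘, M) → Č²(𝔚, M)`, Görtz–Wedhorn II (21.16)).

* **THE HEAD `refineC2_obstructionCochain`**: for ANY family `ψ^W` of restricted lifts and ANY obstruction cochain `o` of `ψ`
  on `𝔘`, the refined cochain `ρ_τ o` SATISFIES F2's characterisation for `ψ^W` on `𝔚` — the refined cochain IS an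
  obstruction cochain of the restricted lifts (exactly, not up to a coboundary: the restrictions `σ` of the `ψ^W`'s to
  `W s ∩ W t ∩ W r` restrict the restrictions `ρ` of the `ψ`'s along `U³ → W³ = D(a s|·a t|·a r|)`, and ★ F2
  `tangentSheaf_section_rep_restrict_discrepancy`);
* `discrepancy_refine_sub_mem` — the restricted lifts are admissible (F2's `hcoc` clause holds on `𝔚`);
* `obstructionCochain_refine_eq_refineC2` — every obstruction cochain of `ψ^W` EQUALS `ρ_τ o`;
* `refineC2_sub_obstructionCochain_mem_cechMB2` — hence `ρ_τ o − o^W ∈ B̌²(𝔚, 𝒯_{X/k})` (the letter of cell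
  `hodgecm-mathlib` (R74): the restriction-along-`τ` half of the COVER INDEPENDENCE of the obstruction class, slot (4) rel₂
  of the (iv-5) assembly; the same-cover half is the `f := 𝟙` case of the functoriality file).

HC_CM is proved only modulo the 7 printed citations until rung 0 closes — nothing here bears on a summit statement.

## References
* [Hartshorne2010] R. Hartshorne, *Deformation Theory*, GTM 257, Springer (2010): Thm. 10.2 (a) and its proof (p. 81),
  Remark 10.1.1 (p. 80).
* [GortzWedhorn2023] U. Görtz, T. Wedhorn, *Algebraic Geometry II*, Springer Spektrum (2023): (21.16) Def. 21.71 and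
  Lemma 21.72 (p. 262).
* [Hartshorne1977] R. Hartshorne, *Algebraic Geometry*, GTM 52 (1977): III §4 p. 218 (Čech cochains on an affine cover).
-/

noncomputable section

-- `TopCat.Presheaf`/`TopCat.Sheaf` are not reducible (as in Mathlib's `AlgebraicGeometry/Modules`).
set_option backward.isDefEq.respectTransparency false

open CategoryTheory AlgebraicGeometry Opposite TopologicalSpace
open scoped TensorProduct

universe u

namespace Literature.AlgebraicGeometry.Deformation

open Literature.AlgebraicGeometry.HodgeTheory Literature.AlgebraicGeometry.Modules
  Literature.AlgebraicGeometry.Motives Literature.AlgebraicGeometry.Morphisms SmoothAffineDeformation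

variable {k : Type u} [Field k] {X : Over (Spec (CommRingCat.of k))}
  [instΓ : ∀ W : X.left.Opens, Algebra k Γ(X.left, W)]
  (halg : ∀ (W : X.left.Opens) (s : k), algebraMap k Γ(X.left, W) s = (constToPresheaf X).app (op W) s)
  {A' : Type u} [CommRing A'] [Algebra k A']
  {ι : Type u} (U : ι → X.left.affineOpens) (b : (j l : ι) → Γ(X.left, (U j).1))
  (hb : ∀ j l, (U j).1 ⊓ (U l).1 = X.left.basicOpen (b j l))
  {κ : Type u} (W : κ → X.left.Opens) (τ : κ → ι) (hτ : ∀ s, W s ≤ (U (τ s)).1)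
  (a : (s : κ) → Γ(X.left, (U (τ s)).1)) (hWa : ∀ s, W s = X.left.basicOpen (a s))

/-! ## §4 The refined obstruction cochain is an obstruction cochain of the restricted lifts -/

section Head

variable (J 𝔫' : Ideal A') (hJ : J * J = ⊥) (e : ↥(J.restrictScalars k) ≃ₗ[k] k)

include halg hb hWa hJ in
/-- **THE REFINED COCHAIN IS AN OBSTRUCTION COCHAIN OF THE RESTRICTED LIFTS.** For lifted transition automorphisms `ψ`
on the principal affine cover `𝔘` (`≡ 1 (mod 𝔫')`, `𝔫'` nilpotent), an obstruction cochain `o ∈ Č²(𝔘, 𝒯_{X/k})` of `ψ`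
(★ F2's characterisation: `o j l m` represents the discrepancy `ρ_lm ρ_jl ρ_jm⁻¹` of any restrictions of the `ψ`'s to
`U j ∩ U l ∩ U m`), a refinement `𝔚` of `𝔘` by basic opens (`W s = D(a s) ⊆ U (τ s)`) and ANY family `ψ^W` of restrictions
of the `ψ (τ s) (τ t)` to `A' ⊗_k Γ(W s ∩ W t)`: the REFINED cochain `(ρ_τ o) s t r = o (τ s) (τ t) (τ r)|_{W s ∩ W t ∩ W r}`
represents the discrepancy `σ_tr σ_st σ_sr⁻¹` of any restrictions `σ` of the `ψ^W`'s to `W s ∩ W t ∩ W r` — i.e. `ρ_τ o`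
satisfies F2's characterisation for `ψ^W` on `𝔚` VERBATIM (the `σ`'s restrict the `ρ`'s along
`U³ → W³ = D(a s|·a t|·a r|)`, ★ F2 `tangentSheaf_section_rep_restrict_discrepancy`).
[cite: Hartshorne2010, Thm. 10.2 (proof), p. 81] [cite: GortzWedhorn2023, (21.16) Lemma 21.72 (p. 262)] -/
theorem refineC2_obstructionCochain (h𝔫 : IsNilpotent 𝔫')
    (ψ : (j l : ι) → A' ⊗[k] Γ(X.left, (U j).1 ⊓ (U l).1) ≃ₐ[A'] A' ⊗[k] Γ(X.left, (U j).1 ⊓ (U l).1))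
    (hψ : ∀ j l x, ψ j l x - x ∈ 𝔫' • (⊤ : Submodule A' (A' ⊗[k] Γ(X.left, (U j).1 ⊓ (U l).1))))
    (o : CechMC2 X.hom (tangentSheaf X) (fun j => (U j).1))
    (ho : ∀ (j l m : ι)
      (Φjl : A' ⊗[k] Γ(X.left, (U j).1 ⊓ (U l).1) →ₐ[A'] A' ⊗[k] Γ(X.left, (U j).1 ⊓ (U l).1 ⊓ (U m).1))
      (_ : ∀ a s, Φjl (a ⊗ₜ s) = a ⊗ₜ X.left.presheaf.map (homOfLE inf_le_left).op s)
      (Φlm : A' ⊗[k] Γ(X.left, (U l).1 ⊓ (U m).1) →ₐ[A'] A' ⊗[k] Γ(X.left, (U j).1 ⊓ (U l).1 ⊓ (U m).1))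
      (_ : ∀ a s, Φlm (a ⊗ₜ s) = a ⊗ₜ X.left.presheaf.map
        (homOfLE (le_inf (inf_le_left.trans inf_le_right) inf_le_right)).op s)
      (Φjm : A' ⊗[k] Γ(X.left, (U j).1 ⊓ (U m).1) →ₐ[A'] A' ⊗[k] Γ(X.left, (U j).1 ⊓ (U l).1 ⊓ (U m).1))
      (_ : ∀ a s, Φjm (a ⊗ₜ s) = a ⊗ₜ X.left.presheaf.map
        (homOfLE (le_inf (inf_le_left.trans inf_le_left) inf_le_right)).op s)
      (ρjl ρlm ρjm : A' ⊗[k] Γ(X.left, (U j).1 ⊓ (U l).1 ⊓ (U m).1) ≃ₐ[A']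
        A' ⊗[k] Γ(X.left, (U j).1 ⊓ (U l).1 ⊓ (U m).1)),
      (∀ x, ρjl (Φjl x) = Φjl (ψ j l x)) → (∀ x, ρlm (Φlm x) = Φlm (ψ l m x)) →
      (∀ x, ρjm (Φjm x) = Φjm (ψ j m x)) →
      ∀ c : Γ(X.left, (U j).1 ⊓ (U l).1 ⊓ (U m).1), (ρlm * ρjl * ρjm⁻¹) ((1 : A') ⊗ₜ c) =
        (1 : A') ⊗ₜ c + ((e.symm 1 : ↥(J.restrictScalars k)) : A') ⊗ₜ
          (show Γ(X.left, (U j).1 ⊓ (U l).1 ⊓ (U m).1) from appLE (o j l m) (𝟙 _) (dSection X _ c)))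
    (ψW : (s t : κ) → A' ⊗[k] Γ(X.left, W s ⊓ W t) ≃ₐ[A'] A' ⊗[k] Γ(X.left, W s ⊓ W t))
    (hψW : ∀ (s t : κ) (Φ : A' ⊗[k] Γ(X.left, (U (τ s)).1 ⊓ (U (τ t)).1) →ₐ[A'] A' ⊗[k] Γ(X.left, W s ⊓ W t)),
      (∀ a' x, Φ (a' ⊗ₜ x) = a' ⊗ₜ X.left.presheaf.map (homOfLE (inf_le_inf (hτ s) (hτ t))).op x) →
      ∀ x, ψW s t (Φ x) = Φ (ψ (τ s) (τ t) x))
    (s t r : κ)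
    (ΦWst : A' ⊗[k] Γ(X.left, W s ⊓ W t) →ₐ[A'] A' ⊗[k] Γ(X.left, W s ⊓ W t ⊓ W r))
    (hΦWst : ∀ a' x, ΦWst (a' ⊗ₜ x) = a' ⊗ₜ X.left.presheaf.map (homOfLE inf_le_left).op x)
    (ΦWtr : A' ⊗[k] Γ(X.left, W t ⊓ W r) →ₐ[A'] A' ⊗[k] Γ(X.left, W s ⊓ W t ⊓ W r))
    (hΦWtr : ∀ a' x, ΦWtr (a' ⊗ₜ x) = a' ⊗ₜ X.left.presheaf.map
      (homOfLE (le_inf (inf_le_left.trans inf_le_right) inf_le_right)).op x)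
    (ΦWsr : A' ⊗[k] Γ(X.left, W s ⊓ W r) →ₐ[A'] A' ⊗[k] Γ(X.left, W s ⊓ W t ⊓ W r))
    (hΦWsr : ∀ a' x, ΦWsr (a' ⊗ₜ x) = a' ⊗ₜ X.left.presheaf.map
      (homOfLE (le_inf (inf_le_left.trans inf_le_left) inf_le_right)).op x)
    (σst σtr σsr : A' ⊗[k] Γ(X.left, W s ⊓ W t ⊓ W r) ≃ₐ[A'] A' ⊗[k] Γ(X.left, W s ⊓ W t ⊓ W r))
    (hσst : ∀ y, σst (ΦWst y) = ΦWst (ψW s t y)) (hσtr : ∀ y, σtr (ΦWtr y) = ΦWtr (ψW t r y))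
    (hσsr : ∀ y, σsr (ΦWsr y) = ΦWsr (ψW s r y)) (c : Γ(X.left, W s ⊓ W t ⊓ W r)) :
    (σtr * σst * σsr⁻¹) ((1 : A') ⊗ₜ c) =
      (1 : A') ⊗ₜ c + ((e.symm 1 : ↥(J.restrictScalars k)) : A') ⊗ₜ
        (show Γ(X.left, W s ⊓ W t ⊓ W r) from
          appLE (cechMRefineC2 X.hom (tangentSheaf X) (fun j => (U j).1) W τ hτ o s t r) (𝟙 _) (dSection X _ c)) := by
  -- the triple overlap `U³` of the coarse cover is principal in its three pairwise overlaps (★ F2 §4)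
  have hW₃jl : (U (τ s)).1 ⊓ (U (τ t)).1 ⊓ (U (τ r)).1 = X.left.basicOpen (X.left.presheaf.map
      (homOfLE (inf_le_left : (U (τ s)).1 ⊓ (U (τ t)).1 ≤ (U (τ s)).1)).op (b (τ s) (τ r))) :=
    inf_eq_basicOpen_map U b hb inf_le_left (τ r)
  have hW₃lm : (U (τ s)).1 ⊓ (U (τ t)).1 ⊓ (U (τ r)).1 = X.left.basicOpen (X.left.presheaf.map
      (homOfLE (inf_le_left : (U (τ t)).1 ⊓ (U (τ r)).1 ≤ (U (τ t)).1)).op (b (τ t) (τ s))) := by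
    rw [← inf_eq_basicOpen_map U b hb inf_le_left (τ s)]
    ac_rfl
  have hW₃jm : (U (τ s)).1 ⊓ (U (τ t)).1 ⊓ (U (τ r)).1 = X.left.basicOpen (X.left.presheaf.map
      (homOfLE (inf_le_left : (U (τ s)).1 ⊓ (U (τ r)).1 ≤ (U (τ s)).1)).op (b (τ s) (τ t))) := by
    rw [← inf_eq_basicOpen_map U b hb inf_le_left (τ t)]
    ac_rfl
  -- base changes `U² → U³` and the restrictions of the `ψ`'s (★ F1)
  obtain ⟨Φjl, hΦjl⟩ := exists_baseChangeMap (A' := A') halg ((U (τ s)).1 ⊓ (U (τ t)).1)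
    ((U (τ s)).1 ⊓ (U (τ t)).1 ⊓ (U (τ r)).1) inf_le_left
  obtain ⟨Φlm, hΦlm⟩ := exists_baseChangeMap (A' := A') halg ((U (τ t)).1 ⊓ (U (τ r)).1)
    ((U (τ s)).1 ⊓ (U (τ t)).1 ⊓ (U (τ r)).1) (le_inf (inf_le_left.trans inf_le_right) inf_le_right)
  obtain ⟨Φjm, hΦjm⟩ := exists_baseChangeMap (A' := A') halg ((U (τ s)).1 ⊓ (U (τ r)).1)
    ((U (τ s)).1 ⊓ (U (τ t)).1 ⊓ (U (τ r)).1) (le_inf (inf_le_left.trans inf_le_left) inf_le_right)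
  obtain ⟨ρjl, hρjl, -⟩ := exists_algEquiv_restrict halg 𝔫' (isAffineOpen_inf₂ U b hb (τ s) (τ t)) _ hW₃jl
    inf_le_left h𝔫 (ψ (τ s) (τ t)) (hψ _ _) hΦjl
  obtain ⟨ρlm, hρlm, -⟩ := exists_algEquiv_restrict halg 𝔫' (isAffineOpen_inf₂ U b hb (τ t) (τ r)) _ hW₃lm
    (le_inf (inf_le_left.trans inf_le_right) inf_le_right) h𝔫 (ψ (τ t) (τ r)) (hψ _ _) hΦlm
  obtain ⟨ρjm, hρjm, -⟩ := exists_algEquiv_restrict halg 𝔫' (isAffineOpen_inf₂ U b hb (τ s) (τ r)) _ hW₃jm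
    (le_inf (inf_le_left.trans inf_le_left) inf_le_right) h𝔫 (ψ (τ s) (τ r)) (hψ _ _) hΦjm
  -- `o (τ s) (τ t) (τ r)` represents their discrepancy
  have hθ := ho (τ s) (τ t) (τ r) Φjl hΦjl Φlm hΦlm Φjm hΦjm ρjl ρlm ρjm hρjl hρlm hρjm
  -- the base changes `U³ → W³` and `U² → W²`
  have h3 : W s ⊓ W t ⊓ W r ≤ (U (τ s)).1 ⊓ (U (τ t)).1 ⊓ (U (τ r)).1 := inf_le_inf (inf_le_inf (hτ s) (hτ t)) (hτ r)
  obtain ⟨Φ₄, hΦ₄⟩ := exists_baseChangeMap (A' := A') halg ((U (τ s)).1 ⊓ (U (τ t)).1 ⊓ (U (τ r)).1)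
    (W s ⊓ W t ⊓ W r) h3
  obtain ⟨Θst, hΘst⟩ := exists_baseChangeMap (A' := A') halg ((U (τ s)).1 ⊓ (U (τ t)).1) (W s ⊓ W t)
    (inf_le_inf (hτ s) (hτ t))
  obtain ⟨Θtr, hΘtr⟩ := exists_baseChangeMap (A' := A') halg ((U (τ t)).1 ⊓ (U (τ r)).1) (W t ⊓ W r)
    (inf_le_inf (hτ t) (hτ r))
  obtain ⟨Θsr, hΘsr⟩ := exists_baseChangeMap (A' := A') halg ((U (τ s)).1 ⊓ (U (τ r)).1) (W s ⊓ W r)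
    (inf_le_inf (hτ s) (hτ r))
  -- the `σ`'s restrict the `ρ`'s along `U³ → W³`
  have hσ₁ : ∀ y, σst (Φ₄ y) = Φ₄ (ρjl y) :=
    restrict_compat_of_refine halg (isAffineOpen_inf₂ U b hb (τ s) (τ t)) _ hW₃jl inf_le_left
      (inf_le_inf (hτ s) (hτ t)) h3 inf_le_left (ψ (τ s) (τ t)) hΦjl hΘst hΦ₄ hΦWst hρjl (hψW s t Θst hΘst) hσst
  have hσ₂ : ∀ y, σtr (Φ₄ y) = Φ₄ (ρlm y) :=
    restrict_compat_of_refine halg (isAffineOpen_inf₂ U b hb (τ t) (τ r)) _ hW₃lm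
      (le_inf (inf_le_left.trans inf_le_right) inf_le_right) (inf_le_inf (hτ t) (hτ r)) h3
      (le_inf (inf_le_left.trans inf_le_right) inf_le_right) (ψ (τ t) (τ r)) hΦlm hΘtr hΦ₄ hΦWtr hρlm
      (hψW t r Θtr hΘtr) hσtr
  have hσ₃ : ∀ y, σsr (Φ₄ y) = Φ₄ (ρjm y) :=
    restrict_compat_of_refine halg (isAffineOpen_inf₂ U b hb (τ s) (τ r)) _ hW₃jm
      (le_inf (inf_le_left.trans inf_le_left) inf_le_right) (inf_le_inf (hτ s) (hτ r)) h3
      (le_inf (inf_le_left.trans inf_le_left) inf_le_right) (ψ (τ s) (τ r)) hΦjm hΘsr hΦ₄ hΦWsr hρjm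
      (hψW s r Θsr hΘsr) hσsr
  -- ★ F2: the restricted representing section represents the restricted discrepancy
  exact tangentSheaf_section_rep_restrict_discrepancy halg J hJ e (isAffineOpen_inf₃ U b hb (τ s) (τ t) (τ r)) _
    (refine_inf₃_eq_basicOpen U W τ hτ a hWa s t r) h3 hθ hΦ₄ hσ₁ hσ₂ hσ₃ c

include halg hb hWa hJ e in
/-- **The restricted lifts are admissible** (F2's `hcoc` clause on the refinement): if the triple discrepancies of the
`ψ`'s are `≡ 1 (mod J)` (their reductions glue over `A'/J`), so are those of any restrictions `ψ^W` to the refinement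
(an obstruction cochain exists on `𝔘`, ★ F2 `exists_obstructionCochain`; its refinement represents the discrepancies on
`𝔚`; represented automorphisms are `≡ 1 (mod J)`). [cite: Hartshorne2010, Thm. 10.2 (proof), p. 81] -/
theorem discrepancy_refine_sub_mem (h𝔫 : IsNilpotent 𝔫')
    (ψ : (j l : ι) → A' ⊗[k] Γ(X.left, (U j).1 ⊓ (U l).1) ≃ₐ[A'] A' ⊗[k] Γ(X.left, (U j).1 ⊓ (U l).1))
    (hψ : ∀ j l x, ψ j l x - x ∈ 𝔫' • (⊤ : Submodule A' (A' ⊗[k] Γ(X.left, (U j).1 ⊓ (U l).1))))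
    (hcoc : ∀ (j l m : ι)
      (Φjl : A' ⊗[k] Γ(X.left, (U j).1 ⊓ (U l).1) →ₐ[A'] A' ⊗[k] Γ(X.left, (U j).1 ⊓ (U l).1 ⊓ (U m).1))
      (_ : ∀ a s, Φjl (a ⊗ₜ s) = a ⊗ₜ X.left.presheaf.map (homOfLE inf_le_left).op s)
      (Φlm : A' ⊗[k] Γ(X.left, (U l).1 ⊓ (U m).1) →ₐ[A'] A' ⊗[k] Γ(X.left, (U j).1 ⊓ (U l).1 ⊓ (U m).1))
      (_ : ∀ a s, Φlm (a ⊗ₜ s) = a ⊗ₜ X.left.presheaf.map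
        (homOfLE (le_inf (inf_le_left.trans inf_le_right) inf_le_right)).op s)
      (Φjm : A' ⊗[k] Γ(X.left, (U j).1 ⊓ (U m).1) →ₐ[A'] A' ⊗[k] Γ(X.left, (U j).1 ⊓ (U l).1 ⊓ (U m).1))
      (_ : ∀ a s, Φjm (a ⊗ₜ s) = a ⊗ₜ X.left.presheaf.map
        (homOfLE (le_inf (inf_le_left.trans inf_le_left) inf_le_right)).op s)
      (ρjl ρlm ρjm : A' ⊗[k] Γ(X.left, (U j).1 ⊓ (U l).1 ⊓ (U m).1) ≃ₐ[A']
        A' ⊗[k] Γ(X.left, (U j).1 ⊓ (U l).1 ⊓ (U m).1)),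
      (∀ x, ρjl (Φjl x) = Φjl (ψ j l x)) → (∀ x, ρlm (Φlm x) = Φlm (ψ l m x)) →
      (∀ x, ρjm (Φjm x) = Φjm (ψ j m x)) →
      ∀ y, (ρlm * ρjl * ρjm⁻¹) y - y ∈ J • (⊤ : Submodule A' (A' ⊗[k] Γ(X.left, (U j).1 ⊓ (U l).1 ⊓ (U m).1))))
    (ψW : (s t : κ) → A' ⊗[k] Γ(X.left, W s ⊓ W t) ≃ₐ[A'] A' ⊗[k] Γ(X.left, W s ⊓ W t))
    (hψW : ∀ (s t : κ) (Φ : A' ⊗[k] Γ(X.left, (U (τ s)).1 ⊓ (U (τ t)).1) →ₐ[A'] A' ⊗[k] Γ(X.left, W s ⊓ W t)),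
      (∀ a' x, Φ (a' ⊗ₜ x) = a' ⊗ₜ X.left.presheaf.map (homOfLE (inf_le_inf (hτ s) (hτ t))).op x) →
      ∀ x, ψW s t (Φ x) = Φ (ψ (τ s) (τ t) x))
    (s t r : κ)
    (ΦWst : A' ⊗[k] Γ(X.left, W s ⊓ W t) →ₐ[A'] A' ⊗[k] Γ(X.left, W s ⊓ W t ⊓ W r))
    (hΦWst : ∀ a' x, ΦWst (a' ⊗ₜ x) = a' ⊗ₜ X.left.presheaf.map (homOfLE inf_le_left).op x)
    (ΦWtr : A' ⊗[k] Γ(X.left, W t ⊓ W r) →ₐ[A'] A' ⊗[k] Γ(X.left, W s ⊓ W t ⊓ W r))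
    (hΦWtr : ∀ a' x, ΦWtr (a' ⊗ₜ x) = a' ⊗ₜ X.left.presheaf.map
      (homOfLE (le_inf (inf_le_left.trans inf_le_right) inf_le_right)).op x)
    (ΦWsr : A' ⊗[k] Γ(X.left, W s ⊓ W r) →ₐ[A'] A' ⊗[k] Γ(X.left, W s ⊓ W t ⊓ W r))
    (hΦWsr : ∀ a' x, ΦWsr (a' ⊗ₜ x) = a' ⊗ₜ X.left.presheaf.map
      (homOfLE (le_inf (inf_le_left.trans inf_le_left) inf_le_right)).op x)
    (σst σtr σsr : A' ⊗[k] Γ(X.left, W s ⊓ W t ⊓ W r) ≃ₐ[A'] A' ⊗[k] Γ(X.left, W s ⊓ W t ⊓ W r))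
    (hσst : ∀ y, σst (ΦWst y) = ΦWst (ψW s t y)) (hσtr : ∀ y, σtr (ΦWtr y) = ΦWtr (ψW t r y))
    (hσsr : ∀ y, σsr (ΦWsr y) = ΦWsr (ψW s r y)) (y : A' ⊗[k] Γ(X.left, W s ⊓ W t ⊓ W r)) :
    (σtr * σst * σsr⁻¹) y - y ∈ J • (⊤ : Submodule A' (A' ⊗[k] Γ(X.left, W s ⊓ W t ⊓ W r))) := by
  obtain ⟨o, ho⟩ := exists_obstructionCochain halg U b hb J 𝔫' hJ e h𝔫 ψ hψ hcoc
  exact sub_mem_of_rep J e (refineC2_obstructionCochain halg U b hb W τ hτ a hWa J 𝔫' hJ e h𝔫 ψ hψ o ho ψW hψW s t r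
    ΦWst hΦWst ΦWtr hΦWtr ΦWsr hΦWsr σst σtr σsr hσst hσtr hσsr) y

include halg hb hWa hJ in
/-- **Every obstruction cochain of the restricted lifts is the refined cochain**: if `o^W ∈ Č²(𝔚, 𝒯_{X/k})` satisfies F2's
characterisation for `ψ^W` (restricted lifts, `≡ 1 (mod 𝔫')`), then `o^W = ρ_τ o` (the representing section over the affine
`W s ∩ W t ∩ W r` is unique, ★ F2 `tangentSheaf_section_rep_unique`; the restrictions `σ` of the `ψ^W`'s to the triple overlap
exist because `W s ∩ W t ∩ W r` is principal in `W s ∩ W t`). [cite: Hartshorne2010, Thm. 10.2 (proof), p. 81]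
[cite: GortzWedhorn2023, (21.16) Lemma 21.72 (p. 262)] -/
theorem obstructionCochain_refine_eq_refineC2 (h𝔫 : IsNilpotent 𝔫')
    (ψ : (j l : ι) → A' ⊗[k] Γ(X.left, (U j).1 ⊓ (U l).1) ≃ₐ[A'] A' ⊗[k] Γ(X.left, (U j).1 ⊓ (U l).1))
    (hψ : ∀ j l x, ψ j l x - x ∈ 𝔫' • (⊤ : Submodule A' (A' ⊗[k] Γ(X.left, (U j).1 ⊓ (U l).1))))
    (o : CechMC2 X.hom (tangentSheaf X) (fun j => (U j).1))
    (ho : ∀ (j l m : ι)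
      (Φjl : A' ⊗[k] Γ(X.left, (U j).1 ⊓ (U l).1) →ₐ[A'] A' ⊗[k] Γ(X.left, (U j).1 ⊓ (U l).1 ⊓ (U m).1))
      (_ : ∀ a s, Φjl (a ⊗ₜ s) = a ⊗ₜ X.left.presheaf.map (homOfLE inf_le_left).op s)
      (Φlm : A' ⊗[k] Γ(X.left, (U l).1 ⊓ (U m).1) →ₐ[A'] A' ⊗[k] Γ(X.left, (U j).1 ⊓ (U l).1 ⊓ (U m).1))
      (_ : ∀ a s, Φlm (a ⊗ₜ s) = a ⊗ₜ X.left.presheaf.map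
        (homOfLE (le_inf (inf_le_left.trans inf_le_right) inf_le_right)).op s)
      (Φjm : A' ⊗[k] Γ(X.left, (U j).1 ⊓ (U m).1) →ₐ[A'] A' ⊗[k] Γ(X.left, (U j).1 ⊓ (U l).1 ⊓ (U m).1))
      (_ : ∀ a s, Φjm (a ⊗ₜ s) = a ⊗ₜ X.left.presheaf.map
        (homOfLE (le_inf (inf_le_left.trans inf_le_left) inf_le_right)).op s)
      (ρjl ρlm ρjm : A' ⊗[k] Γ(X.left, (U j).1 ⊓ (U l).1 ⊓ (U m).1) ≃ₐ[A']
        A' ⊗[k] Γ(X.left, (U j).1 ⊓ (U l).1 ⊓ (U m).1)),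
      (∀ x, ρjl (Φjl x) = Φjl (ψ j l x)) → (∀ x, ρlm (Φlm x) = Φlm (ψ l m x)) →
      (∀ x, ρjm (Φjm x) = Φjm (ψ j m x)) →
      ∀ c : Γ(X.left, (U j).1 ⊓ (U l).1 ⊓ (U m).1), (ρlm * ρjl * ρjm⁻¹) ((1 : A') ⊗ₜ c) =
        (1 : A') ⊗ₜ c + ((e.symm 1 : ↥(J.restrictScalars k)) : A') ⊗ₜ
          (show Γ(X.left, (U j).1 ⊓ (U l).1 ⊓ (U m).1) from appLE (o j l m) (𝟙 _) (dSection X _ c)))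
    (ψW : (s t : κ) → A' ⊗[k] Γ(X.left, W s ⊓ W t) ≃ₐ[A'] A' ⊗[k] Γ(X.left, W s ⊓ W t))
    (hψW : ∀ (s t : κ) (Φ : A' ⊗[k] Γ(X.left, (U (τ s)).1 ⊓ (U (τ t)).1) →ₐ[A'] A' ⊗[k] Γ(X.left, W s ⊓ W t)),
      (∀ a' x, Φ (a' ⊗ₜ x) = a' ⊗ₜ X.left.presheaf.map (homOfLE (inf_le_inf (hτ s) (hτ t))).op x) →
      ∀ x, ψW s t (Φ x) = Φ (ψ (τ s) (τ t) x))
    (hψW𝔫 : ∀ s t y, ψW s t y - y ∈ 𝔫' • (⊤ : Submodule A' (A' ⊗[k] Γ(X.left, W s ⊓ W t))))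
    (oW : CechMC2 X.hom (tangentSheaf X) W)
    (hoW : ∀ (s t r : κ)
      (ΦWst : A' ⊗[k] Γ(X.left, W s ⊓ W t) →ₐ[A'] A' ⊗[k] Γ(X.left, W s ⊓ W t ⊓ W r))
      (_ : ∀ a' x, ΦWst (a' ⊗ₜ x) = a' ⊗ₜ X.left.presheaf.map (homOfLE inf_le_left).op x)
      (ΦWtr : A' ⊗[k] Γ(X.left, W t ⊓ W r) →ₐ[A'] A' ⊗[k] Γ(X.left, W s ⊓ W t ⊓ W r))
      (_ : ∀ a' x, ΦWtr (a' ⊗ₜ x) = a' ⊗ₜ X.left.presheaf.map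
        (homOfLE (le_inf (inf_le_left.trans inf_le_right) inf_le_right)).op x)
      (ΦWsr : A' ⊗[k] Γ(X.left, W s ⊓ W r) →ₐ[A'] A' ⊗[k] Γ(X.left, W s ⊓ W t ⊓ W r))
      (_ : ∀ a' x, ΦWsr (a' ⊗ₜ x) = a' ⊗ₜ X.left.presheaf.map
        (homOfLE (le_inf (inf_le_left.trans inf_le_left) inf_le_right)).op x)
      (σst σtr σsr : A' ⊗[k] Γ(X.left, W s ⊓ W t ⊓ W r) ≃ₐ[A'] A' ⊗[k] Γ(X.left, W s ⊓ W t ⊓ W r)),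
      (∀ y, σst (ΦWst y) = ΦWst (ψW s t y)) → (∀ y, σtr (ΦWtr y) = ΦWtr (ψW t r y)) →
      (∀ y, σsr (ΦWsr y) = ΦWsr (ψW s r y)) →
      ∀ c : Γ(X.left, W s ⊓ W t ⊓ W r), (σtr * σst * σsr⁻¹) ((1 : A') ⊗ₜ c) =
        (1 : A') ⊗ₜ c + ((e.symm 1 : ↥(J.restrictScalars k)) : A') ⊗ₜ
          (show Γ(X.left, W s ⊓ W t ⊓ W r) from appLE (oW s t r) (𝟙 _) (dSection X _ c))) :
    oW = cechMRefineC2 X.hom (tangentSheaf X) (fun j => (U j).1) W τ hτ o := by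
  funext s t r
  -- the triple overlap `W³` is principal in the three pairwise overlaps of the refinement
  obtain ⟨gst, hgst⟩ := exists_refine_inf₃_eq_basicOpen₂ U b hb W τ hτ a hWa s t r
  obtain ⟨gtr, hgtr'⟩ := exists_refine_inf₃_eq_basicOpen₂ U b hb W τ hτ a hWa t r s
  have hgtr : W s ⊓ W t ⊓ W r = X.left.basicOpen gtr := by
    rw [← hgtr']
    ac_rfl
  obtain ⟨gsr, hgsr'⟩ := exists_refine_inf₃_eq_basicOpen₂ U b hb W τ hτ a hWa s r t
  have hgsr : W s ⊓ W t ⊓ W r = X.left.basicOpen gsr := by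
    rw [← hgsr']
    ac_rfl
  -- base changes `W² → W³` and restrictions of the `ψ^W`'s (★ F1)
  obtain ⟨ΦWst, hΦWst⟩ := exists_baseChangeMap (A' := A') halg (W s ⊓ W t) (W s ⊓ W t ⊓ W r) inf_le_left
  obtain ⟨ΦWtr, hΦWtr⟩ := exists_baseChangeMap (A' := A') halg (W t ⊓ W r) (W s ⊓ W t ⊓ W r)
    (le_inf (inf_le_left.trans inf_le_right) inf_le_right)
  obtain ⟨ΦWsr, hΦWsr⟩ := exists_baseChangeMap (A' := A') halg (W s ⊓ W r) (W s ⊓ W t ⊓ W r)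
    (le_inf (inf_le_left.trans inf_le_left) inf_le_right)
  obtain ⟨σst, hσst, -⟩ := exists_algEquiv_restrict halg 𝔫' (isAffineOpen_refine_inf₂ U b hb W τ hτ a hWa s t) _ hgst
    inf_le_left h𝔫 (ψW s t) (hψW𝔫 s t) hΦWst
  obtain ⟨σtr, hσtr, -⟩ := exists_algEquiv_restrict halg 𝔫' (isAffineOpen_refine_inf₂ U b hb W τ hτ a hWa t r) _ hgtr
    (le_inf (inf_le_left.trans inf_le_right) inf_le_right) h𝔫 (ψW t r) (hψW𝔫 t r) hΦWtr
  obtain ⟨σsr, hσsr, -⟩ := exists_algEquiv_restrict halg 𝔫' (isAffineOpen_refine_inf₂ U b hb W τ hτ a hWa s r) _ hgsr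
    (le_inf (inf_le_left.trans inf_le_left) inf_le_right) h𝔫 (ψW s r) (hψW𝔫 s r) hΦWsr
  -- both sections represent the same discrepancy over the affine `W³`
  exact tangentSheaf_section_rep_unique J e (isAffineOpen_refine_inf₃ U b hb W τ hτ a hWa s t r)
    (hoW s t r ΦWst hΦWst ΦWtr hΦWtr ΦWsr hΦWsr σst σtr σsr hσst hσtr hσsr)
    (refineC2_obstructionCochain halg U b hb W τ hτ a hWa J 𝔫' hJ e h𝔫 ψ hψ o ho ψW hψW s t r
      ΦWst hΦWst ΦWtr hΦWtr ΦWsr hΦWsr σst σtr σsr hσst hσtr hσsr)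

include halg hb hWa hJ in
/-- **The letter of (R74): `ρ_τ o − o^W` is a Čech `2`-coboundary on the refinement** (it is `0`, by
`obstructionCochain_refine_eq_refineC2`) — the restriction-along-`τ` half of the cover independence of the obstruction class.
[cite: Hartshorne2010, Thm. 10.2 (proof), p. 81] [cite: GortzWedhorn2023, (21.16) Lemma 21.72 (p. 262)] -/
theorem refineC2_sub_obstructionCochain_mem_cechMB2 (h𝔫 : IsNilpotent 𝔫')
    (ψ : (j l : ι) → A' ⊗[k] Γ(X.left, (U j).1 ⊓ (U l).1) ≃ₐ[A'] A' ⊗[k] Γ(X.left, (U j).1 ⊓ (U l).1))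
    (hψ : ∀ j l x, ψ j l x - x ∈ 𝔫' • (⊤ : Submodule A' (A' ⊗[k] Γ(X.left, (U j).1 ⊓ (U l).1))))
    (o : CechMC2 X.hom (tangentSheaf X) (fun j => (U j).1))
    (ho : ∀ (j l m : ι)
      (Φjl : A' ⊗[k] Γ(X.left, (U j).1 ⊓ (U l).1) →ₐ[A'] A' ⊗[k] Γ(X.left, (U j).1 ⊓ (U l).1 ⊓ (U m).1))
      (_ : ∀ a s, Φjl (a ⊗ₜ s) = a ⊗ₜ X.left.presheaf.map (homOfLE inf_le_left).op s)
      (Φlm : A' ⊗[k] Γ(X.left, (U l).1 ⊓ (U m).1) →ₐ[A'] A' ⊗[k] Γ(X.left, (U j).1 ⊓ (U l).1 ⊓ (U m).1))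
      (_ : ∀ a s, Φlm (a ⊗ₜ s) = a ⊗ₜ X.left.presheaf.map
        (homOfLE (le_inf (inf_le_left.trans inf_le_right) inf_le_right)).op s)
      (Φjm : A' ⊗[k] Γ(X.left, (U j).1 ⊓ (U m).1) →ₐ[A'] A' ⊗[k] Γ(X.left, (U j).1 ⊓ (U l).1 ⊓ (U m).1))
      (_ : ∀ a s, Φjm (a ⊗ₜ s) = a ⊗ₜ X.left.presheaf.map
        (homOfLE (le_inf (inf_le_left.trans inf_le_left) inf_le_right)).op s)
      (ρjl ρlm ρjm : A' ⊗[k] Γ(X.left, (U j).1 ⊓ (U l).1 ⊓ (U m).1) ≃ₐ[A']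
        A' ⊗[k] Γ(X.left, (U j).1 ⊓ (U l).1 ⊓ (U m).1)),
      (∀ x, ρjl (Φjl x) = Φjl (ψ j l x)) → (∀ x, ρlm (Φlm x) = Φlm (ψ l m x)) →
      (∀ x, ρjm (Φjm x) = Φjm (ψ j m x)) →
      ∀ c : Γ(X.left, (U j).1 ⊓ (U l).1 ⊓ (U m).1), (ρlm * ρjl * ρjm⁻¹) ((1 : A') ⊗ₜ c) =
        (1 : A') ⊗ₜ c + ((e.symm 1 : ↥(J.restrictScalars k)) : A') ⊗ₜ
          (show Γ(X.left, (U j).1 ⊓ (U l).1 ⊓ (U m).1) from appLE (o j l m) (𝟙 _) (dSection X _ c)))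
    (ψW : (s t : κ) → A' ⊗[k] Γ(X.left, W s ⊓ W t) ≃ₐ[A'] A' ⊗[k] Γ(X.left, W s ⊓ W t))
    (hψW : ∀ (s t : κ) (Φ : A' ⊗[k] Γ(X.left, (U (τ s)).1 ⊓ (U (τ t)).1) →ₐ[A'] A' ⊗[k] Γ(X.left, W s ⊓ W t)),
      (∀ a' x, Φ (a' ⊗ₜ x) = a' ⊗ₜ X.left.presheaf.map (homOfLE (inf_le_inf (hτ s) (hτ t))).op x) →
      ∀ x, ψW s t (Φ x) = Φ (ψ (τ s) (τ t) x))
    (hψW𝔫 : ∀ s t y, ψW s t y - y ∈ 𝔫' • (⊤ : Submodule A' (A' ⊗[k] Γ(X.left, W s ⊓ W t))))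
    (oW : CechMC2 X.hom (tangentSheaf X) W)
    (hoW : ∀ (s t r : κ)
      (ΦWst : A' ⊗[k] Γ(X.left, W s ⊓ W t) →ₐ[A'] A' ⊗[k] Γ(X.left, W s ⊓ W t ⊓ W r))
      (_ : ∀ a' x, ΦWst (a' ⊗ₜ x) = a' ⊗ₜ X.left.presheaf.map (homOfLE inf_le_left).op x)
      (ΦWtr : A' ⊗[k] Γ(X.left, W t ⊓ W r) →ₐ[A'] A' ⊗[k] Γ(X.left, W s ⊓ W t ⊓ W r))
      (_ : ∀ a' x, ΦWtr (a' ⊗ₜ x) = a' ⊗ₜ X.left.presheaf.map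
        (homOfLE (le_inf (inf_le_left.trans inf_le_right) inf_le_right)).op x)
      (ΦWsr : A' ⊗[k] Γ(X.left, W s ⊓ W r) →ₐ[A'] A' ⊗[k] Γ(X.left, W s ⊓ W t ⊓ W r))
      (_ : ∀ a' x, ΦWsr (a' ⊗ₜ x) = a' ⊗ₜ X.left.presheaf.map
        (homOfLE (le_inf (inf_le_left.trans inf_le_left) inf_le_right)).op x)
      (σst σtr σsr : A' ⊗[k] Γ(X.left, W s ⊓ W t ⊓ W r) ≃ₐ[A'] A' ⊗[k] Γ(X.left, W s ⊓ W t ⊓ W r)),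
      (∀ y, σst (ΦWst y) = ΦWst (ψW s t y)) → (∀ y, σtr (ΦWtr y) = ΦWtr (ψW t r y)) →
      (∀ y, σsr (ΦWsr y) = ΦWsr (ψW s r y)) →
      ∀ c : Γ(X.left, W s ⊓ W t ⊓ W r), (σtr * σst * σsr⁻¹) ((1 : A') ⊗ₜ c) =
        (1 : A') ⊗ₜ c + ((e.symm 1 : ↥(J.restrictScalars k)) : A') ⊗ₜ
          (show Γ(X.left, W s ⊓ W t ⊓ W r) from appLE (oW s t r) (𝟙 _) (dSection X _ c))) :
    cechMRefineC2 X.hom (tangentSheaf X) (fun j => (U j).1) W τ hτ o - oW ∈ cechMB2 X.hom (tangentSheaf X) W := by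
  rw [obstructionCochain_refine_eq_refineC2 halg U b hb W τ hτ a hWa J 𝔫' hJ e h𝔫 ψ hψ o ho ψW hψW hψW𝔫 oW hoW,
    sub_self]
  exact Submodule.zero_mem _

end Head

end Literature.AlgebraicGeometry.Deformation

end
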